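import Literature.Topology.FourManifolds.TrisectionsTriNormalForm
import Summits.SmoothPoincare4.SmoothPoincare4.Theorems.CongruenceShadowsAgkCor6SufficiencySpineDefs

/-!
# Stub `stub_tubeStructure` of line `lp-by-sphere-system-surgery` for crux `AgkCor6Sufficiency`
(item stmt-SmoothPoincare4-10894, routes CongruenceShadows / GroupTrisection; lead reshape r5, TS)

**The product structure of a normal frame along the central surface.**  For a normal frame
`(F, u, v, ρ, U, O)` (`NormalFrame`, `TrisectionsSectorNormalForm.lean`) carrying corner-slice
charts with sources in `O` at the points of the compact surface `F`, the map
`Ξ = (ρ, u, v)` is a bijection of an open `Ot`, `F ⊆ Ot ⊆ O`, onto `F × D_rt`, and its inverse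
`tp` has the chart formula `tp p a b = Θ⁻¹ (a, b, (Θ p)₂, (Θ p)₃)` near every point of `F`
(`TubeStructure`, `…SpineDefs.lean`).

Proof.  In ONE corner-slice chart `Θ = (u, v, (Θ ∘ ρ)₂, (Θ ∘ ρ)₃)` (`CornerSliceChart.apply_π`),
so `Ξ` is injective on each chart source (`cornerSlice_injOn`) and has the local inverse
`(p, a, b) ↦ Θ⁻¹ (a, b, (Θ p)₂, (Θ p)₃)` (`slice_symm`, by `CornerSliceChart.π_symm_eq`).  Since
`ρ = id` on `F`, `Ξ` is injective on the compact `F`, hence on an open `W₀ ⊇ F` (Mathlib's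
`Set.InjOn.exists_isOpen_superset`); put `W₁ = W₀ ∩ O`.  By compactness of `F`
(`exists_slice_radius`: finitely many charts, a ball about `Θ pᵢ` inside each target whose
preimage lies in a prescribed open `W' ⊇ F`, and the triangle inequality
`|(a, b, (Θ p')₂, (Θ p')₃) - Θ pᵢ| ≤ √(a² + b²) + |Θ p' - Θ pᵢ|`) there is `rt > 0` such that the
local inverses over all of `F × D_rt` are defined and land in `W₁`; so `Ξ|W₁` hits `F × D_rt`,
`tp` is its inverse there, `Ot = {x ∈ W₁ | u² + v² < rt²}`, and the chart formula holds by
injectivity on `W₁`.  The neighbourhood-basis clause is `exists_slice_radius` again, applied to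
`W' = O' ∩ W₁`: a point of the `r`-tube equals the local inverse of its own `Ξ`-value, which
lies in `O'`.  (Abrams–Gay–Kirby use this product neighbourhood `F × D²` of the central surface
throughout the proof of Thm. 5; Gay–Kirby, Def. 1.)

References: Abrams–Gay–Kirby, Geom. Topol. 22 (2018), proof of Thm. 5 [AbramsGayKirby2018];
Gay–Kirby, Geom. Topol. 20 (2016), Def. 1 [GayKirby2016]; Douady, Séminaire H. Cartan 14
(1961/62), exp. 1, §4 (product neighbourhoods of corner strata) [Douady1961].
-/

noncomputable section

-- the prescribed namespace `Summit.<P>.<Sub>.…` duplicates `SmoothPoincare4` (P = Sub)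
set_option linter.dupNamespace false

open Set Function Filter
open scoped Manifold ContDiff Topology

namespace Summit.SmoothPoincare4.SmoothPoincare4.Cruxes.AgkCor6Sufficiency.LpBySphereSystemSurgery

open Literature.Topology.FourManifolds

/-! ## The statement (verbatim from the skeleton) -/

/-- **TS — the product structure of a normal frame** (`Ξ = (ρ, u, v)` is injective near the
compact `F` where it is a local homeomorphism by the corner-slice charts, and its image contains
a product `F × D_r` by compactness). -/
def TubeStructureStmt : Prop :=
  ∀ (X : Type) [TopologicalSpace X] [T2Space X] [SecondCountableTopology X]
    [ChartedSpace (EuclideanSpace ℝ (Fin 4)) X] [IsManifold (𝓡 4) ∞ X] [CompactSpace X]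
    (S₀ F : Set X) (u v : X → ℝ) (ρ : X → X) (U O : Set X),
    NormalFrame F u v ρ U O →
    (∀ x ∈ F, ∃ C : CornerSliceChart S₀ F u v ρ, x ∈ C.Θ.source ∧ C.Θ.source ⊆ O) →
    ∃ (Ot : Set X) (rt : ℝ) (tp : X → ℝ → ℝ → X), TubeStructure S₀ F u v ρ O Ot rt tp

/-! ## One corner-slice chart: injectivity of `Ξ` and the local inverse -/

section Local

variable {X : Type} [TopologicalSpace X] [ChartedSpace (EuclideanSpace ℝ (Fin 4)) X]
  {S₀ F : Set X} {u v : X → ℝ} {ρ : X → X}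

/-- In a corner-slice chart, `Θ q = (u q, v q, (Θ (ρ q))₂, (Θ (ρ q))₃)`. -/
theorem cornerSlice_apply_eq (C : CornerSliceChart S₀ F u v ρ) {q : X} (hq : q ∈ C.Θ.source) :
    C.Θ q = !₂[u q, v q, C.Θ (ρ q) 2, C.Θ (ρ q) 3] := by
  ext i
  fin_cases i
  · exact C.apply_zero q hq
  · exact C.apply_one q hq
  · show C.Θ q 2 = C.Θ (ρ q) 2
    rw [C.apply_π q hq, stratumProj_apply_two]
  · show C.Θ q 3 = C.Θ (ρ q) 3
    rw [C.apply_π q hq, stratumProj_apply_three]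

/-- In one corner-slice chart, `Ξ = (ρ, u, v)` is injective. -/
theorem cornerSlice_injOn (C : CornerSliceChart S₀ F u v ρ) {q q' : X} (hq : q ∈ C.Θ.source)
    (hq' : q' ∈ C.Θ.source) (hρ : ρ q = ρ q') (hu : u q = u q') (hv : v q = v q') : q = q' :=
  C.Θ.injOn hq hq' (by rw [cornerSlice_apply_eq C hq, cornerSlice_apply_eq C hq', hρ, hu, hv])

/-- The slice vector `(a, b, (Θ p)₂, (Θ p)₃)` over a point `p ∈ F`: its stratum projection is
`Θ p`. -/
theorem stratumProj_slice (C : CornerSliceChart S₀ F u v ρ) {p : X} (hp : p ∈ C.Θ.source)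
    (hpF : p ∈ F) (a b : ℝ) :
    stratumProj (!₂[a, b, C.Θ p 2, C.Θ p 3]) = C.Θ p := by
  rw [C.apply_eq_stratumProj_of_mem_K hp hpF]
  ext i
  fin_cases i <;> rfl

/-- **The local inverse of `Ξ`**: for `p ∈ F`, the point `z = Θ⁻¹ (a, b, (Θ p)₂, (Θ p)₃)` has
`ρ z = p`, `u z = a`, `v z = b`. -/
theorem slice_symm (C : CornerSliceChart S₀ F u v ρ) {p : X} (hp : p ∈ C.Θ.source)
    (hpF : p ∈ F) {a b : ℝ}
    (hy : (!₂[a, b, C.Θ p 2, C.Θ p 3] : EuclideanSpace ℝ (Fin 4)) ∈ C.Θ.target) :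
    ρ (C.Θ.symm (!₂[a, b, C.Θ p 2, C.Θ p 3])) = p ∧
      u (C.Θ.symm (!₂[a, b, C.Θ p 2, C.Θ p 3])) = a ∧
      v (C.Θ.symm (!₂[a, b, C.Θ p 2, C.Θ p 3])) = b := by
  refine ⟨?_, ?_, ?_⟩
  · rw [C.π_symm_eq hy, stratumProj_slice C hp hpF, C.Θ.left_inv hp]
  · rw [← C.apply_zero _ (C.Θ.map_target hy), C.Θ.right_inv hy]; rfl
  · rw [← C.apply_one _ (C.Θ.map_target hy), C.Θ.right_inv hy]; rfl

/-- The slice vector over `p ∈ F` is at distance `√(a² + b²)` from `Θ p = (0, 0, (Θ p)₂, (Θ p)₃)`. -/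
theorem dist_slice (C : CornerSliceChart S₀ F u v ρ) {p : X} (hp : p ∈ C.Θ.source)
    (hpF : p ∈ F) (a b : ℝ) :
    dist (!₂[a, b, C.Θ p 2, C.Θ p 3] : EuclideanSpace ℝ (Fin 4)) (C.Θ p) = √(a ^ 2 + b ^ 2) := by
  obtain ⟨h0, h1⟩ := (C.mem_K_iff_apply hp).1 hpF
  rw [EuclideanSpace.dist_eq, Fin.sum_univ_four]
  have e0 : (!₂[a, b, C.Θ p 2, C.Θ p 3] : EuclideanSpace ℝ (Fin 4)) 0 = a := rfl
  have e1 : (!₂[a, b, C.Θ p 2, C.Θ p 3] : EuclideanSpace ℝ (Fin 4)) 1 = b := rfl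
  have e2 : (!₂[a, b, C.Θ p 2, C.Θ p 3] : EuclideanSpace ℝ (Fin 4)) 2 = C.Θ p 2 := rfl
  have e3 : (!₂[a, b, C.Θ p 2, C.Θ p 3] : EuclideanSpace ℝ (Fin 4)) 3 = C.Θ p 3 := rfl
  rw [e0, e1, e2, e3, h0, h1, dist_self, dist_self, Real.dist_eq, Real.dist_eq, sub_zero, sub_zero,
    sq_abs, sq_abs]
  ring_nf

/-- For `a² + b² < r²` (`r > 0`) the slice vector over `p ∈ F` is within `r` of `Θ p`. -/
theorem dist_slice_lt (C : CornerSliceChart S₀ F u v ρ) {p : X} (hp : p ∈ C.Θ.source)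
    (hpF : p ∈ F) {a b r : ℝ} (hr : 0 < r) (hab : a ^ 2 + b ^ 2 < r ^ 2) :
    dist (!₂[a, b, C.Θ p 2, C.Θ p 3] : EuclideanSpace ℝ (Fin 4)) (C.Θ p) < r := by
  rw [dist_slice C hp hpF]
  exact (Real.sqrt_lt' hr).2 hab

/-- A positive lower bound for finitely many positive reals. -/
theorem exists_pos_le_finset {ι : Type} (t : Finset ι) (f : ι → ℝ) (hf : ∀ i ∈ t, 0 < f i) :
    ∃ r : ℝ, 0 < r ∧ ∀ i ∈ t, r ≤ f i := by
  rcases t.eq_empty_or_nonempty with rfl | hne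
  · exact ⟨1, one_pos, by simp⟩
  · exact ⟨t.inf' hne f, (Finset.lt_inf'_iff hne).2 hf, fun i hi => Finset.inf'_le f hi⟩

/-- **Uniform radius of the local inverses** (compactness of `F`).  For every open `W' ⊇ F`
there is `r > 0` such that every `p ∈ F` has a corner-slice chart `C` (source in `O`) and an
open `W ∋ p` in its source with: for `p' ∈ W ∩ F` and `a² + b² < r²`, the slice vector
`(a, b, (Θ p')₂, (Θ p')₃)` lies in the target of `C` and its preimage lies in `W'`.  (Cover `F`
by the sets `V_p = Θ_p⁻¹ B(Θ_p p, ε_p / 2)`, `B(Θ_p p, ε_p) ⊆ target ∩ Θ_p (W')`, extract a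
finite subcover, `r = min ε_{pᵢ} / 2`, triangle inequality.) -/
theorem exists_slice_radius {O : Set X} (hF : IsCompact F)
    (hcharts : ∀ x ∈ F, ∃ C : CornerSliceChart S₀ F u v ρ, x ∈ C.Θ.source ∧ C.Θ.source ⊆ O)
    {W' : Set X} (hW' : IsOpen W') (hFW' : F ⊆ W') :
    ∃ r : ℝ, 0 < r ∧ ∀ p ∈ F, ∃ (C : CornerSliceChart S₀ F u v ρ) (W : Set X), IsOpen W ∧ p ∈ W ∧
      W ⊆ C.Θ.source ∧ C.Θ.source ⊆ O ∧
      ∀ p' ∈ W, p' ∈ F → ∀ a b : ℝ, a ^ 2 + b ^ 2 < r ^ 2 →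
        (!₂[a, b, C.Θ p' 2, C.Θ p' 3] : EuclideanSpace ℝ (Fin 4)) ∈ C.Θ.target ∧
        C.Θ.symm (!₂[a, b, C.Θ p' 2, C.Θ p' 3]) ∈ W' := by
  -- a chart at every point of `F`
  choose C hC using fun p : F => hcharts p.1 p.2
  -- a ball about `Θ p` inside the target whose preimage lies in `W'`
  have key : ∀ p : F, ∃ ε : ℝ, 0 < ε ∧ ∀ y : EuclideanSpace ℝ (Fin 4),
      dist y ((C p).Θ p) < ε → y ∈ (C p).Θ.target ∧ (C p).Θ.symm y ∈ W' := by
    intro p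
    have ho : IsOpen ((C p).Θ.target ∩ (C p).Θ.symm ⁻¹' W') :=
      (C p).Θ.isOpen_inter_preimage_symm hW'
    have hmem : (C p).Θ p ∈ (C p).Θ.target ∩ (C p).Θ.symm ⁻¹' W' :=
      ⟨(C p).Θ.map_source (hC p).1, by
        rw [mem_preimage, (C p).Θ.left_inv (hC p).1]; exact hFW' p.2⟩
    obtain ⟨ε, hε, hball⟩ := Metric.isOpen_iff.1 ho _ hmem
    exact ⟨ε, hε, fun y hy => hball (Metric.mem_ball.2 hy)⟩
  choose ε hε hεP using key
  -- the open cover of `F` and a finite subcover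
  set V : F → Set X := fun p => (C p).Θ.source ∩ (C p).Θ ⁻¹' Metric.ball ((C p).Θ p) (ε p / 2)
    with hV
  have hVo : ∀ p, IsOpen (V p) := fun p => (C p).Θ.isOpen_inter_preimage Metric.isOpen_ball
  have hVmem : ∀ p : F, (p : X) ∈ V p := fun p =>
    ⟨(hC p).1, Metric.mem_ball_self (half_pos (hε p))⟩
  obtain ⟨t, ht⟩ := hF.elim_finite_subcover V hVo
    (fun p hp => mem_iUnion.2 ⟨⟨p, hp⟩, hVmem ⟨p, hp⟩⟩)
  obtain ⟨r, hr, hrle⟩ := exists_pos_le_finset t (fun p => ε p / 2) (fun p _ => half_pos (hε p))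
  refine ⟨r, hr, fun p hp => ?_⟩
  obtain ⟨i, hit, hpi⟩ : ∃ i ∈ t, p ∈ V i := by simpa only [mem_iUnion, exists_prop] using ht hp
  refine ⟨C i, V i, hVo i, hpi, inter_subset_left, (hC i).2, fun p' hp' hp'F a b hab => ?_⟩
  apply hεP i
  calc dist (!₂[a, b, (C i).Θ p' 2, (C i).Θ p' 3] : EuclideanSpace ℝ (Fin 4)) ((C i).Θ i)
      ≤ dist (!₂[a, b, (C i).Θ p' 2, (C i).Θ p' 3] : EuclideanSpace ℝ (Fin 4)) ((C i).Θ p') +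
          dist ((C i).Θ p') ((C i).Θ i) := dist_triangle _ _ _
    _ < ε i / 2 + ε i / 2 :=
        add_lt_add (dist_slice_lt (C i) hp'.1 hp'F (half_pos (hε i))
          (lt_of_lt_of_le hab (pow_le_pow_left₀ hr.le (hrle i hit) 2))) (Metric.mem_ball.1 hp'.2)
    _ = ε i := add_halves _

end Local

/-! ## The proof -/

/-- **Registered stub `stub_tubeStructure`** (TS of line `lp-by-sphere-system-surgery`): the
product structure `Ξ = (ρ, u, v) : Ot ≅ F × D_rt` of a normal frame along the compact central
surface, with inverse `tp` and its corner-slice chart formula. -/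
theorem stub_tubeStructure : TubeStructureStmt := by
  intro X _ _ _ _ _ _ S₀ F u v ρ U O hfr hcharts
  classical
  have hu : Continuous u := hfr.contMDiff_u.continuous
  have hv : Continuous v := hfr.contMDiff_v.continuous
  have hρ : Continuous ρ := hfr.contMDiff_ρ.continuous
  -- Step 1: `Ξ = (ρ, u, v)` is injective on an open neighbourhood `W₀` of `F`
  obtain ⟨W₀, hW₀o, hFW₀, hinj⟩ :
      ∃ W₀ : Set X, IsOpen W₀ ∧ F ⊆ W₀ ∧ InjOn (fun x => (ρ x, u x, v x)) W₀ := by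
    refine InjOn.exists_isOpen_superset ?_ hfr.isCompact_F
      (fun x _ => (hρ.prodMk (hu.prodMk hv)).continuousAt) ?_
    · intro p hp p' hp' h
      have h1 : ρ p = ρ p' := congrArg Prod.fst h
      rwa [hfr.ρ_eq_self_of_mem hp, hfr.ρ_eq_self_of_mem hp'] at h1
    · intro x hx
      obtain ⟨C, hxC, -⟩ := hcharts x hx
      refine ⟨C.Θ.source, C.Θ.open_source.mem_nhds hxC, fun q hq q' hq' h => ?_⟩
      exact cornerSlice_injOn C hq hq' (congrArg Prod.fst h) (congrArg (fun z => z.2.1) h)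
        (congrArg (fun z => z.2.2) h)
  -- `W₁ = W₀ ∩ O`
  set W₁ : Set X := W₀ ∩ O with hW₁
  have hW₁o : IsOpen W₁ := hW₀o.inter hfr.isOpen_O
  have hFW₁ : F ⊆ W₁ := subset_inter hFW₀ hfr.F_subset_O
  have hinj₁ : ∀ z ∈ W₁, ∀ z' ∈ W₁, ρ z = ρ z' → u z = u z' → v z = v z' → z = z' :=
    fun z hz z' hz' h1 h2 h3 => hinj hz.1 hz'.1 (show (ρ z, u z, v z) = (ρ z', u z', v z') by
      rw [h1, h2, h3])
  -- Step 2: the uniform radius `rt` for the local inverses to land in `W₁`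
  obtain ⟨rt, hrt, hsl⟩ := exists_slice_radius hfr.isCompact_F hcharts hW₁o hFW₁
  -- Step 3: the inverse `tp` of `Ξ|W₁`
  set tp : X → ℝ → ℝ → X := fun p a b =>
    if h : ∃ z ∈ W₁, ρ z = p ∧ u z = a ∧ v z = b then h.choose else p with htp
  have tp_eq : ∀ z ∈ W₁, ∀ p a b, ρ z = p → u z = a → v z = b → tp p a b = z := by
    intro z hz p a b h1 h2 h3
    have h : ∃ z ∈ W₁, ρ z = p ∧ u z = a ∧ v z = b := ⟨z, hz, h1, h2, h3⟩
    have e : tp p a b = h.choose := dif_pos h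
    rw [e]
    obtain ⟨hz', h1', h2', h3'⟩ := h.choose_spec
    exact hinj₁ _ hz' _ hz (h1'.trans h1.symm) (h2'.trans h2.symm) (h3'.trans h3.symm)
  -- the values of `tp` on `F × D_rt`
  have htpF : ∀ p ∈ F, ∀ a b : ℝ, a ^ 2 + b ^ 2 < rt ^ 2 →
      tp p a b ∈ W₁ ∧ ρ (tp p a b) = p ∧ u (tp p a b) = a ∧ v (tp p a b) = b := by
    intro p hp a b hab
    obtain ⟨C, W, -, hpW, hWs, -, hP⟩ := hsl p hp
    obtain ⟨hy, hz⟩ := hP p hpW hp a b hab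
    obtain ⟨h1, h2, h3⟩ := slice_symm C (hWs hpW) hp hy
    rw [tp_eq _ hz p a b h1 h2 h3]
    exact ⟨hz, h1, h2, h3⟩
  have hF0 : ∀ p ∈ F, u p = 0 ∧ v p = 0 := fun p hp => (hfr.memF_iff p (hfr.F_subset_U hp)).1 hp
  refine ⟨tubeSet W₁ u v rt, rt, tp, ?_⟩
  exact
    { isOpen := hW₁o.inter (isOpen_lt ((hu.pow 2).add (hv.pow 2)) continuous_const)
      F_subset := fun p hp => ⟨hFW₁ hp, by
        rw [(hF0 p hp).1, (hF0 p hp).2]; simpa using pow_pos hrt 2⟩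
      subset_O := fun x hx => hx.1.2
      rt_pos := hrt
      sq_lt := fun x hx => hx.2
      tp_mem := fun p hp a b hab => by
        obtain ⟨hz, -, h2, h3⟩ := htpF p hp a b hab
        exact ⟨hz, by rw [h2, h3]; exact hab⟩
      ρ_tp := fun p hp a b hab => (htpF p hp a b hab).2.1
      u_tp := fun p hp a b hab => (htpF p hp a b hab).2.2.1
      v_tp := fun p hp a b hab => (htpF p hp a b hab).2.2.2
      tp_self := fun x hx => tp_eq x hx.1 _ _ _ rfl rfl rfl
      basis := by
        intro O' hO' hFO'
        obtain ⟨r, hr, hsl'⟩ :=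
          exists_slice_radius hfr.isCompact_F hcharts (hO'.inter hW₁o) (subset_inter hFO' hFW₁)
        refine ⟨min r rt, lt_min hr hrt, min_le_right _ _, fun x hx => ?_⟩
        have hxW₁ : x ∈ W₁ := hx.1.1
        have hρx : ρ x ∈ F := hfr.ρ_mem x hxW₁.2
        obtain ⟨C, W, -, hpW, hWs, -, hP⟩ := hsl' (ρ x) hρx
        have hlt : u x ^ 2 + v x ^ 2 < r ^ 2 :=
          lt_of_lt_of_le hx.2 (pow_le_pow_left₀ (lt_min hr hrt).le (min_le_left _ _) 2)
        obtain ⟨hy, hz⟩ := hP (ρ x) hpW hρx (u x) (v x) hlt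
        obtain ⟨h1, h2, h3⟩ := slice_symm C (hWs hpW) hρx hy
        rw [← hinj₁ _ hz.2 x hxW₁ h1 h2 h3]
        exact hz.1
      chart := by
        intro p hp
        obtain ⟨C, W, hWo, hpW, hWs, hsO, hP⟩ := hsl p hp
        refine ⟨C, W, hWo, hpW, hWs, hsO, fun p' hp' hp'F a b hab => ?_⟩
        obtain ⟨hy, hz⟩ := hP p' hp' hp'F a b hab
        obtain ⟨h1, h2, h3⟩ := slice_symm C (hWs hp') hp'F hy
        exact ⟨hy, tp_eq _ hz p' a b h1 h2 h3⟩ }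

end Summit.SmoothPoincare4.SmoothPoincare4.Cruxes.AgkCor6Sufficiency.LpBySphereSystemSurgery

end
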